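import Literature.NumberTheory.EllipticCurves.LocalWeilPairingDuality
import Literature.NumberTheory.GaloisRepresentations.ContinuousH1OrderTwo
import HarnessLib

/-!
# The `E[p]` instance of the N2 parity law, PART III: the local-duality binders `hnd` (local Tate
# duality for `E[p]`) and `hX` (the Kummer condition is its own annihilator) of the group-currency law,
# from the tree's `LocalWeilPairingDuality` — modulo the injectivity of `inv_v` and Tate's local count
# (cell `b2b-bsdres`, unit `b2b-bsdres-x10` = N2 class lead, GEN 31; theorems only, no definition, no
# named fact, nothing booked — glue G2c + G6 of `class-closure/N2/P-INSTANCE-ASK-x10g31.md`)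

HONEST FRAMING (run/shared/lean/b2b/bsd-rank1-residual/, verbatim in every file): the goal of the
cell is to DELETE the COMBINATION-SHAPED residual classes of the Birch–Swinnerton-Dyer formula for
ALL analytic-rank `≤ 1` elliptic curves over `ℚ` — "full BSD formula for every rank `≤ 1` curve in
class `C`" assembled STRICTLY from published theorems — so that the rank-`≤ 1` remainder becomes
exactly the CONSTRUCTION-SHAPED classes, which are TYPED (missing-input `Prop`s), NOT attempted.
This is not "finishing BSD". Class X10b (= N2) keeps its label CONSTRUCTION-SHAPED (NEEDS `X_A3`,
referee R82.3 / RESIDUAL-MAP §I N2); this file is a TOOL; no mark / label / tier / count moves.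

## What

For the dictionary of `X10/ResidualSelmerReciprocity` — `L v = H¹(K_v, E[p])`, `X v = ` the Kummer
condition `W.kummerSelmerStructure p v`, `b v x y = inv_v(x ∪_{e,v} y)` (local Weil cup product, then
an additive `inv_v : H²(K_v, μ_p) → ℤ/p`) — two more binders of
`X10/ResidualSelmerParityGroupForm.even_add_add_card_groupForm` are theorems of the tree up to
displayed inputs:

* **`hnd`** `hnd_groupForm` — `(∀ y, b v x y = 0) → x = 0` at EVERY place: at a finite `v`, local Tate
  duality for the self-dual module `E[p]` (the tree's `eq_zero_of_forall_weilCupProduct_eq_zero_inr`,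
  `LocalWeilPairingDuality.lean`, from the PROVED `localDuality_bijective`) and the injectivity of
  `inv_v` (the conjunct `IsPerfect` of the Poitou–Tate fact gives `Bijective (inv (Sum.inr v))`); at an
  archimedean `w`, `H¹(K_w, E[p]) = 0` for odd `p` (the tree's
  `eq_zero_of_odd_nsmul_galoisCohomology_one_toLocal_inl`, `ContinuousH1OrderTwo.lean`).
* **`hX`** `hX_groupForm` — `x ∈ 𝓛_v ↔ ∀ y ∈ 𝓛_v, b v x y = 0` at every `v ∈ S`: at a finite `v`,
  maximal isotropy of the local Kummer condition (the tree's
  `forall_mem_kummerSelmerStructure_weilCupProduct_eq_zero_iff_inr`: Poonen–Rains isotropy, PROVED, +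
  local duality + counting), which keeps as a displayed hypothesis Tate's local count
  `#H¹(K_v, E[p]) ≤ (#𝓛_v)²` (`hcard`, local Euler characteristic — Milne I 2.8 with Lemma 3.3); at an
  archimedean `w`, both sides hold trivially (`H¹ = 0`).

Inputs displayed as binders: `e` a Weil pairing on `E[p]` (biadditive, `μ_p`-valued, equivariant,
ALTERNATING `e(T, T) = 1`, NON-DEGENERATE), `p` odd, `inv` with `inv (Sum.inr v)` injective, `hcard`.
Nothing else; no fact consumed here (the consumer takes `inv` and its properties from
`poitouTate_selmerStructure_duality`).

## References

* [MilneADT2006] J. S. Milne, *Arithmetic Duality Theorems*, I Cor. 2.3, Thm. 2.8, Lemma 3.3, Cor. 3.4,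
  Lemma 6.15.
* [PoonenRains2012] B. Poonen, E. Rains, J. AMS 25 (2012), Prop. 4.10.
* [KlagsbrunMazurRubin2013] Thm. 3.1, Lemma 5.3; [MazurRubin2007] Prop. 2.1.
* HOME/class-closure/N2/P-INSTANCE-ASK-x10g31.md (G2c, G6); HOME/X10-AUDIT.md §37.
-/

set_option autoImplicit false

noncomputable section

open scoped Classical

open Function WeierstrassCurve Field Literature.NumberTheory.EllipticCurves
  Literature.NumberTheory.GaloisRepresentations Literature.NumberTheory.GaloisCohomology NumberField
  IsDedekindDomain
open Literature.NumberTheory.GaloisRepresentations.DiscreteGaloisModule (mu)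

namespace Summit.BirchSwinnertonDyer.Rank1Residual.X10.ResidualSelmerLocalDuality

-- Cup products need `LocallyCompactSpace Γ_{K_v}` (in the tree a LOCAL instance,
-- `absoluteGaloisGroup_compactSpace`); as in team n1011's files it is an instance HYPOTHESIS here.

variable {K : Type} [Field K] [NumberField K] (W : WeierstrassCurve K) (p : ℕ) [W.IsElliptic]
variable (e : geomTorsion W p → geomTorsion W p → AlgebraicClosure K)
  (hμ : ∀ S T, e S T ^ p = 1)
  (hadd₁ : ∀ S₁ S₂ T, e (S₁ + S₂) T = e S₁ T * e S₂ T)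
  (hadd₂ : ∀ S T₁ T₂, e S (T₁ + T₂) = e S T₁ * e S T₂)
  (hgal : ∀ (σ : absoluteGaloisGroup K) (S T : geomTorsion W p), σ • e S T = e (σ • S) (σ • T))

/-! ### §1. Archimedean places: `H¹(K_w, E[p]) = 0` for odd `p` -/

omit [W.IsElliptic] in
/-- At an archimedean place every class of `H¹(K_w, E[p])` vanishes when `p` is odd (`2 · H¹ = 0` for a
group of order `≤ 2`, and `p · H¹ = 0`). [cite: SerreGaloisCohomology1997, I §2.4] -/
theorem eq_zero_inl (hodd : Odd p) (w : InfinitePlace K)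
    (x : galoisCohomology ((W.torsionGaloisModule p).toLocal (Sum.inl w)) 1) : x = 0 :=
  eq_zero_of_odd_nsmul_galoisCohomology_one_toLocal_inl _ w hodd x
    (galoisCohomology.nsmul_eq_zero_of_forall _ (fun m => AddSubgroup.torsionBy.nsmul m) x)

/-! ### §2. `hnd`: trivial left kernel at every place -/

/-- **`hnd` — local Tate duality for `E[p]` in group currency.** For `b v x y = inv_v(x ∪_{e,v} y)`
with `e` non-degenerate, `inv (Sum.inr v)` injective at the finite places, and `p` odd:
`(∀ y, b v x y = 0) → x = 0` at every place `v`. [cite: MilneADT2006, Ch. I, Cor. 2.3] -/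
theorem hnd_groupForm [NeZero p] [∀ v : Place K, LocallyCompactSpace (absoluteGaloisGroup (Place.Completion v))]
    (hodd : Odd p) (hnondeg : ∀ T, (∀ S, e S T = 1) → T = 0) (inv : LocalInvariants K p)
    (hinj : ∀ v : HeightOneSpectrum (𝓞 K), Injective (inv (Sum.inr v)))
    (b : ∀ v : Place K, galoisCohomology ((W.torsionGaloisModule p).toLocal v) 1 →+
        galoisCohomology ((W.torsionGaloisModule p).toLocal v) 1 →+ ZMod p)
    (hb : ∀ v x y, b v x y = inv v ((weilContPairingLocal W p e hμ hadd₁ hadd₂ hgal v).cupProduct x y))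
    (v : Place K) (x : galoisCohomology ((W.torsionGaloisModule p).toLocal v) 1)
    (hx : ∀ y, b v x y = 0) : x = 0 := by
  rcases v with w | v
  · exact eq_zero_inl W p hodd w x
  · refine eq_zero_of_forall_weilCupProduct_eq_zero_inr W p e hμ hadd₁ hadd₂ v hgal hnondeg x fun y => ?_
    exact hinj v (by rw [← hb, hx y]; exact (map_zero (inv (Sum.inr v))).symm)

/-! ### §3. `hX`: the Kummer condition is its own annihilator on `S` -/

/-- **`hX` — the local Kummer condition is its own annihilator, in group currency.** For
`b v x y = inv_v(x ∪_{e,v} y)` with `e` alternating and non-degenerate, `inv (Sum.inr v)` injective, `p`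
odd, and Tate's count `#H¹(K_v, E[p]) ≤ (#𝓛_v)²` at the finite places of `S` (`hcard`): for every
`v ∈ S`, `x ∈ 𝓛_v ↔ ∀ y ∈ 𝓛_v, b v x y = 0` (`𝓛_v = W.kummerSelmerStructure p v`). At an archimedean
place both sides hold (`H¹ = 0`). [cite: MilneADT2006, Ch. I, Cor. 3.4 and Lemma 6.15]
[cite: PoonenRains2012, Prop. 4.10] -/
theorem hX_groupForm [NeZero p] [∀ v : Place K, LocallyCompactSpace (absoluteGaloisGroup (Place.Completion v))]
    (hodd : Odd p) (halt : ∀ T, e T T = 1) (hnondeg : ∀ T, (∀ S, e S T = 1) → T = 0)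
    (inv : LocalInvariants K p) (hinj : ∀ v : HeightOneSpectrum (𝓞 K), Injective (inv (Sum.inr v)))
    (b : ∀ v : Place K, galoisCohomology ((W.torsionGaloisModule p).toLocal v) 1 →+
        galoisCohomology ((W.torsionGaloisModule p).toLocal v) 1 →+ ZMod p)
    (hb : ∀ v x y, b v x y = inv v ((weilContPairingLocal W p e hμ hadd₁ hadd₂ hgal v).cupProduct x y))
    (S : Finset (Place K))
    (hcard : ∀ v : HeightOneSpectrum (𝓞 K), (Sum.inr v : Place K) ∈ S →
      Nat.card (galoisCohomology ((W.torsionGaloisModule p).toLocal (Sum.inr v)) 1) ≤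
        Nat.card (W.kummerSelmerStructure p (Sum.inr v)) * Nat.card (W.kummerSelmerStructure p (Sum.inr v))) :
    ∀ v ∈ S, ∀ x : galoisCohomology ((W.torsionGaloisModule p).toLocal v) 1,
      x ∈ W.kummerSelmerStructure p v ↔ ∀ y ∈ W.kummerSelmerStructure p v, b v x y = 0 := by
  rintro (w | v) hv x
  · -- archimedean: everything is `0`
    have hx : x = 0 := eq_zero_inl W p hodd w x
    subst hx
    refine ⟨fun _ y _ => ?_, fun _ => zero_mem _⟩
    rw [map_zero, AddMonoidHom.zero_apply]
  · rw [← forall_mem_kummerSelmerStructure_weilCupProduct_eq_zero_iff_inr W p e hμ hadd₁ hadd₂ v hgal halt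
      hnondeg (hcard v hv) x]
    refine forall₂_congr fun y _ => ?_
    rw [hb]
    exact ⟨fun h => (congrArg (inv (Sum.inr v)) h).trans (map_zero _),
      fun h => hinj v (h.trans (map_zero (inv (Sum.inr v))).symm)⟩

end Summit.BirchSwinnertonDyer.Rank1Residual.X10.ResidualSelmerLocalDuality

end
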